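import Summits.ValiantsHypothesis.ValiantsHypothesis.Theorems.SymPencilPerFourHessianRowControl
import Summits.ValiantsHypothesis.ValiantsHypothesis.Theorems.SymPencilPerFourTwoRowsRadical

/-!
# Route `SymPencil` — Hessian rank `≤ 5` on a subspace: the transposed statements
# (column partners and Case Aᵀ of Task T1 of `Cruxes/SdcSuperquadratic/NEXT-RUNG-23.md`;
# `--supports` stmt-ValiantsHypothesis-5674 `SdcSuperquadratic`)

The swapped property ("for every `y ∈ W` the `s²`-coefficient of `per_4 (u + s y)` is a sum of
`|ι|` weighted squares of linear functionals of `u`") is invariant under transposing all matrices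
(`per_4 (zᵀ) = per_4 (z)`, `SymPencilPerFourTwoRowsRadical.eval_perPoly_transpose`):
`sum_sq_swap_transpose`.  Hence the row statements of `SymPencilPerFourHessianMinors` /
`SymPencilPerFourHessianRowControl` have column versions:

* `exists_perm_row_vanish_of_sum_sq_swap` ((CP')): for columns `j ≠ l` and every row `m` there is a
  row `c ≠ m` with `y_{cj} y_{ml} + y_{mj} y_{cl} ≡ 0` on `W` (`|ι| < 6`);
* `finrank_le_four_of_col_onto`: if some column maps `W` onto `K⁴` then `dim W ≤ 4`;
* and, for convenience, `finrank_le_four_of_row_generic`: the rank bound of Case A under the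
  weaker genericity hypothesis of `eq_zero_of_row_generic` (row `a` realises `(1,0)` on every
  ordered pair of columns), which also covers Case B1 (row image a hyperplane `ker κ` with
  `|supp κ| ≥ 3`).

Honest framing: lemmas towards the next rung (`sdc(per_4) ≥ 25` needs Cases B2, B3, C); nothing
here changes `sdc(per_4) ≥ 23`; the crux stays open; `VP ≠ VNP` is not moved. [folklore]
-/

noncomputable section

-- single-conjunct layout: Sub = Summit, duplicated namespace component intended
set_option linter.dupNamespace false

namespace Summit.ValiantsHypothesis.ValiantsHypothesis.Theorems.SymPencilPerFourHessianColControl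

open Matrix MvPolynomial Finset Module
open Literature.Computability.AlgebraicComplexity
open Summit.ValiantsHypothesis.ValiantsHypothesis.Theorems.SymPencilPerFourHessianMinors
open Summit.ValiantsHypothesis.ValiantsHypothesis.Theorems.SymPencilPerFourHessianRowControl
open Summit.ValiantsHypothesis.ValiantsHypothesis.Theorems.SymPencilPerFourTwoRowsRadical

variable {K : Type*} [Field K]

/-- **Case A / B1 under the genericity hypothesis.**  Under the swapped property with `< 6`
squares on `W`, if row `a` realises `(1, 0)` on every ordered pair of distinct columns, then
`finrank W ≤ 4`. [folklore] -/
theorem finrank_le_four_of_row_generic [CharZero K] {ι : Type*} [Fintype ι]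
    (hι : Fintype.card ι < 6) (W : Submodule K (Fin 4 × Fin 4 → K))
    (hW : ∀ y ∈ W, ∃ (c : ι → K) (Λ : ι → ((Fin 4 × Fin 4 → K) →ₗ[K] K)),
      ∀ u : Fin 4 × Fin 4 → K, ∃ e₀ e₁ : K, ∀ s : K,
        eval (u + s • y) (perPoly (Fin 4) K) = e₀ + s * e₁ + s ^ 2 * ∑ k, c k * (Λ k u) ^ 2)
    (a : Fin 4) (hgen : ∀ m c : Fin 4, m ≠ c → ∃ z ∈ W, z (a, m) = 1 ∧ z (a, c) = 0) :
    finrank K W ≤ 4 := by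
  classical
  let ρ : (Fin 4 × Fin 4 → K) →ₗ[K] (Fin 4 → K) := LinearMap.funLeft K K fun j : Fin 4 => (a, j)
  have hρ : ∀ x j, ρ x j = x (a, j) := fun _ _ => rfl
  have hinj : Function.Injective (ρ.domRestrict W) := by
    intro x₁ x₂ h
    have hsub : ((x₁ : Fin 4 × Fin 4 → K) - x₂) ∈ W := W.sub_mem x₁.2 x₂.2
    have hrow : ∀ j, ((x₁ : Fin 4 × Fin 4 → K) - x₂) (a, j) = 0 := fun j => by
      have := congr_fun h j
      simp only [LinearMap.domRestrict_apply, hρ] at this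
      rw [Pi.sub_apply, this, sub_self]
    have h0 := eq_zero_of_row_generic hι W hW a hgen hsub hrow
    exact Subtype.ext (sub_eq_zero.1 h0)
  have h := LinearMap.finrank_le_finrank_of_injective hinj
  rwa [Module.finrank_fintype_fun_eq_card, Fintype.card_fin] at h

/-- **Transposition invariance of the swapped property.**  If every element of `W` has the
swapped property with index type `ι`, so does every element of the transposed space. [folklore] -/
theorem sum_sq_swap_transpose {ι : Type*} [Fintype ι] (W : Submodule K (Fin 4 × Fin 4 → K))
    (hW : ∀ y ∈ W, ∃ (c : ι → K) (Λ : ι → ((Fin 4 × Fin 4 → K) →ₗ[K] K)),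
      ∀ u : Fin 4 × Fin 4 → K, ∃ e₀ e₁ : K, ∀ s : K,
        eval (u + s • y) (perPoly (Fin 4) K) = e₀ + s * e₁ + s ^ 2 * ∑ k, c k * (Λ k u) ^ 2) :
    ∀ y ∈ W.map (LinearEquiv.funCongrLeft K K (Equiv.prodComm (Fin 4) (Fin 4))).toLinearMap,
      ∃ (c : ι → K) (Λ : ι → ((Fin 4 × Fin 4 → K) →ₗ[K] K)),
        ∀ u : Fin 4 × Fin 4 → K, ∃ e₀ e₁ : K, ∀ s : K,
          eval (u + s • y) (perPoly (Fin 4) K) = e₀ + s * e₁ + s ^ 2 * ∑ k, c k * (Λ k u) ^ 2 := by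
  set τ := LinearEquiv.funCongrLeft K K (Equiv.prodComm (Fin 4) (Fin 4)) with hτ
  rintro _ ⟨y, hy, rfl⟩
  obtain ⟨c, Λ, hcΛ⟩ := hW y hy
  refine ⟨c, fun k => (Λ k).comp τ.symm.toLinearMap, fun u => ?_⟩
  obtain ⟨e₀, e₁, hu⟩ := hcΛ (τ.symm u)
  refine ⟨e₀, e₁, fun s => ?_⟩
  have hcomp : u + s • τ y = τ (τ.symm u + s • y) := by
    rw [map_add, map_smul, LinearEquiv.apply_symm_apply]
  rw [LinearEquiv.coe_toLinearMap, hcomp, hτ, eval_perPoly_transpose, ← hτ, hu s]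
  rfl

/-- **Column partners (CP').**  Under the swapped property with `< 6` squares on `W`, for all
columns `j ≠ l` and every row `m` there is a row `c ≠ m` such that the `2 × 2` subpermanent of
rows `m, c` on columns `j, l` vanishes identically on `W`. [folklore] -/
theorem exists_perm_row_vanish_of_sum_sq_swap [CharZero K] {ι : Type*} [Fintype ι]
    (hι : Fintype.card ι < 6) (W : Submodule K (Fin 4 × Fin 4 → K))
    (hW : ∀ y ∈ W, ∃ (c : ι → K) (Λ : ι → ((Fin 4 × Fin 4 → K) →ₗ[K] K)),
      ∀ u : Fin 4 × Fin 4 → K, ∃ e₀ e₁ : K, ∀ s : K,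
        eval (u + s • y) (perPoly (Fin 4) K) = e₀ + s * e₁ + s ^ 2 * ∑ k, c k * (Λ k u) ^ 2)
    (j l m : Fin 4) (hjl : j ≠ l) :
    ∃ c : Fin 4, c ≠ m ∧ ∀ y ∈ W, y (c, j) * y (m, l) + y (m, j) * y (c, l) = 0 := by
  set τ := LinearEquiv.funCongrLeft K K (Equiv.prodComm (Fin 4) (Fin 4)) with hτ
  have hτy : ∀ (y : Fin 4 × Fin 4 → K) (i k : Fin 4), τ y (i, k) = y (k, i) := fun _ _ _ => rfl
  obtain ⟨c, hcm, hc⟩ := exists_perm_col_vanish_of_sum_sq_swap hι (W.map τ.toLinearMap)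
    (sum_sq_swap_transpose W hW) j l m hjl
  refine ⟨c, hcm, fun y hy => ?_⟩
  have h := hc (τ y) ⟨y, hy, rfl⟩
  simpa only [hτy] using h

/-- **Case Aᵀ: a column of rank `4` forces `dim W ≤ 4`.** [folklore] -/
theorem finrank_le_four_of_col_onto [CharZero K] {ι : Type*} [Fintype ι]
    (hι : Fintype.card ι < 6) (W : Submodule K (Fin 4 × Fin 4 → K))
    (hW : ∀ y ∈ W, ∃ (c : ι → K) (Λ : ι → ((Fin 4 × Fin 4 → K) →ₗ[K] K)),
      ∀ u : Fin 4 × Fin 4 → K, ∃ e₀ e₁ : K, ∀ s : K,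
        eval (u + s • y) (perPoly (Fin 4) K) = e₀ + s * e₁ + s ^ 2 * ∑ k, c k * (Λ k u) ^ 2)
    (j : Fin 4) (honto : ∀ v : Fin 4 → K, ∃ z ∈ W, ∀ i, z (i, j) = v i) :
    finrank K W ≤ 4 := by
  set τ := LinearEquiv.funCongrLeft K K (Equiv.prodComm (Fin 4) (Fin 4)) with hτ
  have hτy : ∀ (y : Fin 4 × Fin 4 → K) (i k : Fin 4), τ y (i, k) = y (k, i) := fun _ _ _ => rfl
  have h := finrank_le_four_of_row_onto hι (W.map τ.toLinearMap) (sum_sq_swap_transpose W hW) j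
    (fun v => by
      obtain ⟨z, hz, hzv⟩ := honto v
      exact ⟨τ z, ⟨z, hz, rfl⟩, fun i => by rw [hτy, hzv]⟩)
  rwa [LinearEquiv.finrank_map_eq] at h

end Summit.ValiantsHypothesis.ValiantsHypothesis.Theorems.SymPencilPerFourHessianColControl

end
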